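import Literature.NumberTheory.LFunctions.WeilExplicitFormulaProofs
import Literature.NumberTheory.LFunctions.WeilZeroSum
import Literature.NumberTheory.LFunctions.ZeroCountingDerivZetaProofs
import Literature.NumberTheory.LFunctions.ZetaZeroBoxEnumeration
import Summits.RiemannHypothesis.RiemannHypothesis.Theorems.WeilZeroSideRealEven
import Summits.RiemannHypothesis.RiemannHypothesis.Theorems.SoloInformedZeroSide
import HarnessLib

/-!
# The Weil DETECTION PRINCIPLE (TRACK «HANDOFF», handoff-prove-1 ATTEMPT-5 §3 / ATTEMPT-6 §2)

The skeleton common to Theorems A / A′ / A″ of handoff-prove-1 (windowed Weil converse): if Weil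
positivity holds on `[-b, b]` and `F` is a REAL, EVEN test function supported in `[-b, b]` whose
transform `F̂` vanishes at every zero `ρ` of `ζ` with `0 < Im ρ ≤ T*` outside an exceptional set
`X`, then the (negative) contribution of `X` to the zero side of the explicit formula must be
compensated by the ABSOLUTE mass of the zeros above `T*`:
`-ε ≤ ∑_{ρ ∈ Box(T*) ∩ X} m(ρ) Re F̂(ρ)² + ∑_{T* < Im ρ ≤ T} m(ρ) |F̂(ρ)|²` for all large `T`.
Ingredients (all tree theorems): the explicit formula `explicit_formula_holds`, the square identity
`(F ⋆ F̃)^(ρ) = F̂(ρ)²` for real even `F` (`weilMellin_weilQuadratic_of_real_even`), and the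
conjugation symmetries `m(ρ̄) = m(ρ)`, `F̂(ρ̄) = conj F̂(ρ)` which fold the lower half-plane onto
the upper one (box lemmas REUSED: `disjoint_zetaZeroBox_conj` (SoloInformedZeroSide),
`Montgomery.zetaZeroBox_mono`, `one_sub_conj_mem_zetaZeroBox`). No statement here bears on the
truth of RH.
-/

noncomputable section

set_option linter.dupNamespace false


open Complex Filter Set Topology
open scoped ComplexConjugate

namespace Summit.RiemannHypothesis.RiemannHypothesis.Theorems.WeilConverseWindow

open Literature.NumberTheory.LFunctions
open Summit.RiemannHypothesis.RiemannHypothesis.Theorems.GroundStatesConvergeToXi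

/-- For a REAL, EVEN test function the symmetric zero side is the upper-half sum plus its
conjugate: `∑_{|Im ρ| ≤ T} m(ρ)(F ⋆ F̃)^(ρ) = Z⁺ + conj Z⁺`, `Z⁺ := ∑_{0 < Im ρ ≤ T} m(ρ)F̂(ρ)²`. [folklore] -/
theorem weilZeroSidePartial_eq_upper_add_conj {F : ℝ → ℂ} (hF : IsWeilTest F)
    (hre : ∀ t, (F t).im = 0) (hev : ∀ t, F (-t) = F t) (T : ℝ) :
    weilZeroSidePartial (weilConv F (weilReflect F)) T =
      (∑ᶠ ρ ∈ zetaZeroBox 0 T, (riemannZetaZeroOrder ρ : ℂ) * weilMellin F ρ ^ 2) +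
        conj (∑ᶠ ρ ∈ zetaZeroBox 0 T, (riemannZetaZeroOrder ρ : ℂ) * weilMellin F ρ ^ 2) := by
  have hfin : (zetaZeroBox 0 T).Finite := zetaZeroBox_finite 0 T
  have hfin' : ((starRingEnd ℂ) '' zetaZeroBox 0 T).Finite := hfin.image _
  unfold weilZeroSidePartial
  rw [weilZeroIndex_eq_union, finsum_mem_union (disjoint_zetaZeroBox_conj T) hfin hfin']
  congr 1
  · exact finsum_mem_congr rfl fun ρ _ ↦ by
      rw [weilMellin_weilQuadratic_of_real_even hF hre hev]
  · rw [finsum_mem_image ((starRingEnd ℂ).injective.injOn)]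
    have hmap := AddMonoidHom.map_finsum_mem
      (fun ρ ↦ (riemannZetaZeroOrder ρ : ℂ) * weilMellin F ρ ^ 2) (starRingEnd ℂ : ℂ →+ ℂ) hfin
    simp only [AddMonoidHom.coe_coe] at hmap
    rw [hmap]
    refine finsum_mem_congr rfl fun ρ _ ↦ ?_
    rw [weilMellin_weilQuadratic_of_real_even hF hre hev, riemannZetaZeroOrder_conj_holds ρ,
      weilMellin_conj_of_real hre, map_mul, map_pow, map_intCast]

/-- Hence the real part of the symmetric zero side is twice that of the upper-half sum. [folklore] -/
theorem re_weilZeroSidePartial_of_real_even {F : ℝ → ℂ} (hF : IsWeilTest F)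
    (hre : ∀ t, (F t).im = 0) (hev : ∀ t, F (-t) = F t) (T : ℝ) :
    (weilZeroSidePartial (weilConv F (weilReflect F)) T).re =
      2 * (∑ᶠ ρ ∈ zetaZeroBox 0 T, (riemannZetaZeroOrder ρ : ℂ) * weilMellin F ρ ^ 2).re := by
  rw [weilZeroSidePartial_eq_upper_add_conj hF hre hev, Complex.add_re, Complex.conj_re]
  ring

/-- A point of an upper box is not the pole `1`. [folklore] -/
theorem ne_one_of_mem_zetaZeroBox {T : ℝ} {ρ : ℂ} (h : ρ ∈ zetaZeroBox 0 T) : ρ ≠ 1 := by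
  rintro rfl
  obtain ⟨-, -, -, h3, -⟩ := h
  simp at h3

/-- Termwise bound on the zero side: `Re(m(ρ)·F̂(ρ)²) ≤ m(ρ)·‖F̂(ρ)‖²` (the multiplicity is
non-negative away from the pole). [folklore] -/
theorem re_order_mul_sq_le {ρ : ℂ} (hρ : ρ ≠ 1) (w : ℂ) :
    ((riemannZetaZeroOrder ρ : ℂ) * w ^ 2).re ≤ (riemannZetaZeroOrder ρ : ℝ) * ‖w‖ ^ 2 := by
  have hm : (0 : ℝ) ≤ riemannZetaZeroOrder ρ := by exact_mod_cast riemannZetaZeroOrder_nonneg hρ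
  rw [← Complex.ofReal_intCast, Complex.re_ofReal_mul, ← Complex.norm_pow]
  exact mul_le_mul_of_nonneg_left (Complex.re_le_norm _) hm

/-- **WEIL DETECTION PRINCIPLE.** Let Weil positivity hold on `[-b, b]` and let `F` be a real, even
test function supported in `[-b, b]` whose transform vanishes at every zero `ρ` of `ζ` with
`0 < Im ρ ≤ T*` outside the set `X`. Then for every `ε > 0` and all sufficiently large `T`,
`-ε ≤ Re ∑_{ρ ∈ Box(T*) ∩ X} m(ρ) F̂(ρ)² + ∑_{ρ ∈ Box(T) \ Box(T*)} m(ρ) ‖F̂(ρ)‖²`: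
the exceptional zeros' (possibly negative) contribution is compensated by the absolute mass of the
zeros above the kill height. This is inequality (3.1) of ATTEMPT-5 / (2.1) of ATTEMPT-6 of
handoff-prove-1 (windowed Weil converse), from `explicit_formula_holds`,
`weilMellin_weilQuadratic_of_real_even` and the conjugation symmetries. [handoff-prove-1 ATTEMPT-6 §2] -/
theorem weil_detection {b Tstar : ℝ} {F : ℝ → ℂ} (hW : WeilPositivityOn b) (hF : IsWeilTest F)
    (hsupp : tsupport F ⊆ Icc (-b) b) (hre : ∀ t, (F t).im = 0) (hev : ∀ t, F (-t) = F t)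
    (X : Set ℂ) (hkill : ∀ ρ ∈ zetaZeroBox 0 Tstar, ρ ∉ X → weilMellin F ρ = 0)
    {ε : ℝ} (hε : 0 < ε) :
    ∀ᶠ T in atTop,
      -ε ≤ (∑ᶠ ρ ∈ zetaZeroBox 0 Tstar ∩ X, (riemannZetaZeroOrder ρ : ℂ) * weilMellin F ρ ^ 2).re +
        ∑ᶠ ρ ∈ zetaZeroBox 0 T \ zetaZeroBox 0 Tstar,
          (riemannZetaZeroOrder ρ : ℝ) * ‖weilMellin F ρ‖ ^ 2 := by
  set term : ℂ → ℂ := fun ρ ↦ (riemannZetaZeroOrder ρ : ℂ) * weilMellin F ρ ^ 2 with hterm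
  -- positivity and the explicit formula
  have hQ : 0 ≤ (weilQuadratic F).re := hW F hF hsupp
  have hZ : Tendsto (weilZeroSidePartial (weilConv F (weilReflect F))) atTop
      (𝓝 (weilQuadratic F)) :=
    explicit_formula_holds (hF.weilConv hF.weilReflect)
  have hZre : Tendsto (fun T ↦ (weilZeroSidePartial (weilConv F (weilReflect F)) T).re) atTop
      (𝓝 (weilQuadratic F).re) :=
    (Complex.continuous_re.tendsto _).comp hZ
  have h1 : ∀ᶠ T in atTop,
      (weilQuadratic F).re - 2 * ε < (weilZeroSidePartial (weilConv F (weilReflect F)) T).re :=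
    hZre.eventually (lt_mem_nhds (by linarith))
  filter_upwards [h1, eventually_ge_atTop Tstar] with T hT hTT
  rw [re_weilZeroSidePartial_of_real_even hF hre hev] at hT
  -- split the upper sum at `T*` and at `X`
  have hsub : zetaZeroBox 0 Tstar ⊆ zetaZeroBox 0 T := Montgomery.zetaZeroBox_mono hTT
  have hfinT : (zetaZeroBox 0 T).Finite := zetaZeroBox_finite 0 T
  have hfinS : (zetaZeroBox 0 Tstar).Finite := zetaZeroBox_finite 0 Tstar
  have hfinD : (zetaZeroBox 0 T \ zetaZeroBox 0 Tstar).Finite := hfinT.sdiff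
  have hsplit : (∑ᶠ ρ ∈ zetaZeroBox 0 T, (riemannZetaZeroOrder ρ : ℂ) * weilMellin F ρ ^ 2) =
      (∑ᶠ ρ ∈ zetaZeroBox 0 Tstar ∩ X, term ρ) +
        ∑ᶠ ρ ∈ zetaZeroBox 0 T \ zetaZeroBox 0 Tstar, term ρ := by
    rw [← Set.union_sdiff_cancel hsub, finsum_mem_union Set.disjoint_sdiff_right hfinS hfinD,
      Set.union_sdiff_cancel hsub, ← finsum_mem_inter_add_sdiff X hfinS]
    have h0 : ∑ᶠ ρ ∈ zetaZeroBox 0 Tstar \ X, term ρ = 0 := by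
      refine finsum_mem_of_eqOn_zero fun ρ hρ ↦ ?_
      simp only [hterm, hkill ρ hρ.1 hρ.2, zero_pow two_ne_zero, mul_zero, Pi.zero_apply]
    rw [h0, add_zero]
  -- the tail's real part is at most its absolute mass
  have htail : (∑ᶠ ρ ∈ zetaZeroBox 0 T \ zetaZeroBox 0 Tstar, term ρ).re ≤
      ∑ᶠ ρ ∈ zetaZeroBox 0 T \ zetaZeroBox 0 Tstar,
        (riemannZetaZeroOrder ρ : ℝ) * ‖weilMellin F ρ‖ ^ 2 := by
    rw [finsum_mem_eq_finite_toFinset_sum _ hfinD, finsum_mem_eq_finite_toFinset_sum _ hfinD,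
      Complex.re_sum]
    refine Finset.sum_le_sum fun ρ hρ ↦ ?_
    rw [Set.Finite.mem_toFinset] at hρ
    exact re_order_mul_sq_le (ne_one_of_mem_zetaZeroBox hρ.1) _
  rw [hsplit, Complex.add_re] at hT
  linarith

/-- **Detection of a single off-line zero** (the planted-world / no-near-zero case of
ATTEMPT-5 (3.1), ATTEMPT-6 (2.1)): if Weil positivity holds on `[-b, b]`, `F` is a real even test
function supported in `[-b, b]`, `ρ₀` is an OFF-LINE zero with `0 < Im ρ₀ ≤ T*`, `F̂` kills every
other zero of the box `0 < Im ρ ≤ T*` except `ρ₀` and its reflection `1 - ρ̄₀`, and the PHASE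
condition `Re F̂(ρ₀)² = -‖F̂(ρ₀)‖²` holds, then the zeros above `T*` must carry absolute mass
`∑_{T* < Im ρ ≤ T} m(ρ)‖F̂(ρ)‖² ≥ 2·m(ρ₀)·‖F̂(ρ₀)‖² - ε` for all large `T`. [handoff-prove-1 ATTEMPT-6 §2] -/
theorem weil_detection_offline {b Tstar : ℝ} {F : ℝ → ℂ} (hW : WeilPositivityOn b)
    (hF : IsWeilTest F) (hsupp : tsupport F ⊆ Icc (-b) b) (hre : ∀ t, (F t).im = 0)
    (hev : ∀ t, F (-t) = F t) {ρ₀ : ℂ} (hρ₀ : ρ₀ ∈ zetaZeroBox 0 Tstar) (hoff : ρ₀.re ≠ 1 / 2)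
    (hkill : ∀ ρ ∈ zetaZeroBox 0 Tstar, ρ ≠ ρ₀ → ρ ≠ 1 - conj ρ₀ → weilMellin F ρ = 0)
    (hphase : (weilMellin F ρ₀ ^ 2).re = -‖weilMellin F ρ₀‖ ^ 2) {ε : ℝ} (hε : 0 < ε) :
    ∀ᶠ T in atTop,
      2 * (riemannZetaZeroOrder ρ₀ : ℝ) * ‖weilMellin F ρ₀‖ ^ 2 - ε ≤
        ∑ᶠ ρ ∈ zetaZeroBox 0 T \ zetaZeroBox 0 Tstar,
          (riemannZetaZeroOrder ρ : ℝ) * ‖weilMellin F ρ‖ ^ 2 := by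
  have hX := weil_detection hW hF hsupp hre hev {ρ₀, 1 - conj ρ₀}
    (fun ρ hρ hρX ↦ hkill ρ hρ (fun h ↦ hρX (by simp [h])) (fun h ↦ hρX (by simp [h]))) hε
  have hmem := ZetaZeros.riemannZetaNontrivialZeros.mem_of_im_ne_zero hρ₀.1 hρ₀.2.2.2.1.ne'
  have h0 := ZetaZeros.riemannZetaNontrivialZeros.re_pos hmem
  have h1 := ZetaZeros.riemannZetaNontrivialZeros.re_lt_one hmem
  have hne : ρ₀ ≠ 1 - conj ρ₀ := by
    intro h; apply hoff
    have := congrArg Complex.re h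
    simp only [sub_re, one_re, conj_re] at this
    linarith
  have hinter : zetaZeroBox 0 Tstar ∩ {ρ₀, 1 - conj ρ₀} = {ρ₀, 1 - conj ρ₀} := by
    refine inter_eq_self_of_subset_right ?_
    rintro ρ (rfl | rfl)
    · exact hρ₀
    · exact one_sub_conj_mem_zetaZeroBox hρ₀
  have hm : riemannZetaZeroOrder (1 - conj ρ₀) = riemannZetaZeroOrder ρ₀ :=
    riemannZetaZeroOrder_one_sub_conj h0 h1
  have hw : weilMellin F (1 - conj ρ₀) = conj (weilMellin F ρ₀) := by
    rw [show (1 : ℂ) - conj ρ₀ = conj (1 - ρ₀) by simp, weilMellin_conj_of_real hre,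
      weilMellin_one_sub_of_even hev]
  have hsum : (∑ᶠ ρ ∈ zetaZeroBox 0 Tstar ∩ {ρ₀, 1 - conj ρ₀},
      (riemannZetaZeroOrder ρ : ℂ) * weilMellin F ρ ^ 2).re =
        -(2 * (riemannZetaZeroOrder ρ₀ : ℝ) * ‖weilMellin F ρ₀‖ ^ 2) := by
    rw [hinter, finsum_mem_pair hne, hm, hw, Complex.add_re, ← Complex.ofReal_intCast,
      Complex.re_ofReal_mul, Complex.re_ofReal_mul, ← map_pow, Complex.conj_re, hphase]
    ring
  filter_upwards [hX] with T hT
  rw [hsum] at hT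
  linarith

/-- **A KILLER'S ENERGY IS AT MOST ITS TAIL MASS** (the RH-free skeleton of Theorem B of
handoff-prove-1 ATTEMPT-7): if `F` is a real even test function whose transform vanishes at EVERY
zero of the box `0 < Im ρ ≤ T*`, then for every `ε > 0` and all large `T`,
`Re Q(F) ≤ 2·∑_{ρ ∈ Box(T) \ Box(T*)} m(ρ)‖F̂(ρ)‖² + ε` — no positivity hypothesis and no hypothesis on
the position of any zero (explicit formula + conjugation folding only). [handoff-prove-1 ATTEMPT-7 §1] -/
theorem re_weilQuadratic_le_tail_of_kill {Tstar : ℝ} {F : ℝ → ℂ} (hF : IsWeilTest F)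
    (hre : ∀ t, (F t).im = 0) (hev : ∀ t, F (-t) = F t)
    (hkill : ∀ ρ ∈ zetaZeroBox 0 Tstar, weilMellin F ρ = 0) {ε : ℝ} (hε : 0 < ε) :
    ∀ᶠ T in atTop,
      (weilQuadratic F).re ≤
        2 * ∑ᶠ ρ ∈ zetaZeroBox 0 T \ zetaZeroBox 0 Tstar,
          (riemannZetaZeroOrder ρ : ℝ) * ‖weilMellin F ρ‖ ^ 2 + ε := by
  set term : ℂ → ℂ := fun ρ ↦ (riemannZetaZeroOrder ρ : ℂ) * weilMellin F ρ ^ 2 with hterm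
  have hZ : Tendsto (weilZeroSidePartial (weilConv F (weilReflect F))) atTop
      (𝓝 (weilQuadratic F)) :=
    explicit_formula_holds (hF.weilConv hF.weilReflect)
  have hZre : Tendsto (fun T ↦ (weilZeroSidePartial (weilConv F (weilReflect F)) T).re) atTop
      (𝓝 (weilQuadratic F).re) :=
    (Complex.continuous_re.tendsto _).comp hZ
  have h2 : ∀ᶠ T in atTop,
      (weilQuadratic F).re - ε < (weilZeroSidePartial (weilConv F (weilReflect F)) T).re :=
    hZre.eventually (lt_mem_nhds (by linarith))
  filter_upwards [h2, eventually_ge_atTop Tstar] with T hT hTT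
  rw [re_weilZeroSidePartial_of_real_even hF hre hev] at hT
  have hsub : zetaZeroBox 0 Tstar ⊆ zetaZeroBox 0 T := Montgomery.zetaZeroBox_mono hTT
  have hfinT : (zetaZeroBox 0 T).Finite := zetaZeroBox_finite 0 T
  have hfinS : (zetaZeroBox 0 Tstar).Finite := zetaZeroBox_finite 0 Tstar
  have hfinD : (zetaZeroBox 0 T \ zetaZeroBox 0 Tstar).Finite := hfinT.sdiff
  have hsplit : (∑ᶠ ρ ∈ zetaZeroBox 0 T, (riemannZetaZeroOrder ρ : ℂ) * weilMellin F ρ ^ 2) =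
      ∑ᶠ ρ ∈ zetaZeroBox 0 T \ zetaZeroBox 0 Tstar, term ρ := by
    rw [← Set.union_sdiff_cancel hsub, finsum_mem_union Set.disjoint_sdiff_right hfinS hfinD,
      Set.union_sdiff_cancel hsub]
    have h0 : ∑ᶠ ρ ∈ zetaZeroBox 0 Tstar, term ρ = 0 := by
      refine finsum_mem_of_eqOn_zero fun ρ hρ ↦ ?_
      simp only [hterm, hkill ρ hρ, zero_pow two_ne_zero, mul_zero, Pi.zero_apply]
    rw [h0, zero_add]
  have htail : (∑ᶠ ρ ∈ zetaZeroBox 0 T \ zetaZeroBox 0 Tstar, term ρ).re ≤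
      ∑ᶠ ρ ∈ zetaZeroBox 0 T \ zetaZeroBox 0 Tstar,
        (riemannZetaZeroOrder ρ : ℝ) * ‖weilMellin F ρ‖ ^ 2 := by
    rw [finsum_mem_eq_finite_toFinset_sum _ hfinD, finsum_mem_eq_finite_toFinset_sum _ hfinD,
      Complex.re_sum]
    refine Finset.sum_le_sum fun ρ hρ ↦ ?_
    rw [Set.Finite.mem_toFinset] at hρ
    exact re_order_mul_sq_le (ne_one_of_mem_zetaZeroBox hρ.1) _
  rw [hsplit] at hT
  linarith

end Summit.RiemannHypothesis.RiemannHypothesis.Theorems.WeilConverseWindow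

end
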